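import Literature.MathematicalPhysics.QuantumLattice.VariationalEquilibriumStability
import Literature.MathematicalPhysics.QuantumLattice.OneBandHoppingFamilyMeanEnergyMinimisers
import HarnessLib

/-!
# Layered crystals at `T > 0`, free-boundary form: the 3D box pressures of a layered lattice-fermion model converge, to a limit within
# `β(4/π)Σ|t_z|` of the 2D pressure; thermodynamic-limit equilibrium states of the layered crystal exist and are read by 2D pressures

Topic `Literature/MathematicalPhysics/QuantumLattice` (family `hubbard`; crew hubbard-fast S2/S3 «interlayer coupling at T > 0»). The variational
statements of `LayeredVariationalPressure` / `LayeredHubbardGrandCanonicalVariationalPressure` (`P_{d+1}(layered) ∈ [P_d, P_d + |β|(4/π)Σ|tz|]` for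
Araki–Moriya's variational pressure) become statements about the PHYSICAL (free-boundary) pressures through the Gibbs variational principle
(`FermionGibbsVariationalPrinciple`), once the structural hypotheses (Hermitian, even, translation covariant, finite range) of the layered models are
discharged; and the `IsVarEquilibrium` readings of 3D thermal states by 2D pressures get their subjects from `VariationalEquilibriumExistence`.

* §1 structure of the families: `vectorHoppingModel_isHermitian/_isTranslationInvariant/_hasFiniteRange`, `layeredModel_isHermitian/_isEven/
  _isTranslationInvariant/_hasFiniteRange`, and the `t–t'` instances `layeredHubbardTTPrime_…`, `gcLayeredHubbardTTPrime_…`.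
* §2 **`freePressure_layeredModel_mem_Icc`**: `P_free,d+1(β, layered) ∈ [P_free,d(β, one band), P_free,d + β(4/π)Σ_b|tz_b|]` (`β ≥ 0`, `d ≥ 1`) — the
  `(d+1)`-dimensional free-boundary box pressures `n^{-(d+1)} log Re Tr e^{−βH_{[0,n)^{d+1}}}` CONVERGE (`tendsto_freePressure`) to a limit pinned by the
  `d`-dimensional one; `t–t'` instances incl. **`freePressure_gcLayeredHubbardTTPrime_mem_Icc`: `P_free,3 ∈ [gcPressureTT'Zeeman, + β(4/π)Σ|tz|]`**.
* §3 **thermodynamic-limit equilibrium states of the layered GC `t–t'` crystal EXIST** at every `(β; t,t',U; μ,h; tz)` and EVERY one of them has its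
  density / magnetisation in the windows of three 2D grand-canonical pressures (`exists_isVarEquilibrium_gcLayered_density_mem_Icc`).

Everything is PROVED; no definition, no named fact, no number.

## Tree / Mathlib search

REUSED: `vectorHoppingModel`, `layeredModel`, `layerHom(_ne_zero/_mem_thicken)`, `layeredHubbardTTPrime`, `hubbardTTPrimeFermionInteraction_eq_vectorHoppingModel`,
`ttPrimeVec_ne_zero`, `ttPrimeVec_mem_thicken_one` (`LayeredLatticeEnergyTransport`); `vectorHoppingFermionInteraction_isHermitian/_isEven/_isTranslationInvariant/
_hasFiniteRange`, `HasFiniteRange.of_le`, `norm_le_of_mem_thicken_zero` (`LatticeVectorHoppingInteraction`, `OneBandHoppingFamilyMeanEnergyMinimisers`);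
`hubbardFermionInteraction_*`; `isHermitian/isEven/isTranslationInvariant/hasFiniteRange_linearFamily`; `varPressure_layeredModel_mem_Icc`,
`varPressure_gcLayeredHubbardTTPrime_mem_Icc_gcPressureTT'Zeeman`, `IsVarEquilibrium.density_mem_Icc_of_gcLayered`, `…spinImbalance_mem_Icc_of_gcLayered`;
`varPressure_eq_freePressure`, `tendsto_freePressure`, `gcInteractionTT'_*`, `spinImbalanceInteraction_isTranslationInvariant` (`FermionGibbsVariationalPrinciple`);
`exists_isVarEquilibrium` (`VariationalEquilibriumExistence`).

## References

* O. Bratteli, D. W. Robinson, *OAQSM 2* (1997), Thm. 6.2.40. [cite: BratteliRobinsonII1997, Thm. 6.2.40]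
* R. B. Israel, *Convexity in the Theory of Lattice Gases* (1979), Thm. I.3.4 (Lipschitz), Thm. I.2.4. [cite: Israel1979, Thm. I.2.4]
* E. Pavarini, I. Dasgupta, T. Saha-Dasgupta, O. Jepsen, O. K. Andersen, PRL 87 (2001) 047003 (one-band models with interlayer hopping). [cite: PavariniEtAl2001, eq. (1)]
-/

noncomputable section

open scoped ComplexOrder BigOperators Matrix.Norms.L2Operator
open Finset Literature.InformationTheory.Entropy

namespace Literature.MathematicalPhysics.QuantumLattice

open Matrix HubbardWave0 Literature.Probability.LatticeModels ThermodynamicLimit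
open _root_.Filter
open scoped _root_.Topology

variable {d : ℕ}

/-! ### §1. Structural properties of the hopping families and the layered models -/

section Structure

variable {ι : Type*} [Fintype ι]

/-- The one-band hopping family `Φ^{0,U} + Σ_a θ_a Φ_{u_a}` is Hermitian. [cite: ArakiMoriya2003, §1 assumption (II)] -/
theorem vectorHoppingModel_isHermitian (U : ℝ) (u : ι → Site d) (θ : ι → ℝ) : (vectorHoppingModel U u θ).IsHermitian :=
  FermionInteraction.isHermitian_linearFamily (hubbardFermionInteraction_isHermitian 0 U)
    (fun a => vectorHoppingFermionInteraction_isHermitian (u a) 1) θ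

/-- The one-band hopping family with non-zero jump vectors is translation covariant. [cite: ArakiMoriya2003, §1 assumption (IV)] -/
theorem vectorHoppingModel_isTranslationInvariant (U : ℝ) {u : ι → Site d} (hu : ∀ a, u a ≠ 0) (θ : ι → ℝ) :
    (vectorHoppingModel U u θ).IsTranslationInvariant :=
  FermionInteraction.isTranslationInvariant_linearFamily (hubbardFermionInteraction_isTranslationInvariant 0 U)
    (fun a => vectorHoppingFermionInteraction_isTranslationInvariant (hu a) 1) θ

/-- The one-band hopping family has range `R` as soon as `R ≥ 1` and every jump vector lies in the range box `thicken {0} R`.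
[cite: ArakiMoriya2003, §5.4 (finite range potentials)] -/
theorem vectorHoppingModel_hasFiniteRange (U : ℝ) (u : ι → Site d) (θ : ι → ℝ) {R : ℝ} (hR : 1 ≤ R)
    (huR : ∀ a, u a ∈ thicken ({0} : Finset (Site d)) R) : (vectorHoppingModel U u θ).HasFiniteRange R :=
  FermionInteraction.hasFiniteRange_linearFamily ((hubbardFermionInteraction_hasFiniteRange 0 U).of_le hR)
    (fun a => (vectorHoppingFermionInteraction_hasFiniteRange (u a) 1).of_le
      (norm_le_of_mem_thicken_zero (zero_le_one.trans hR) (huR a))) θ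

variable {κ : Type*} [Fintype κ]

/-- The layered model is Hermitian. [cite: ArakiMoriya2003, §1 assumption (II)] -/
theorem layeredModel_isHermitian (U : ℝ) (u : ι → Site d) (θ : ι → ℝ) (w : κ → Site (d + 1)) (tz : κ → ℝ) :
    (layeredModel U u θ w tz).IsHermitian :=
  vectorHoppingModel_isHermitian U _ _

/-- The layered model is even. [cite: ArakiMoriya2003, §1 assumption (II)] -/
theorem layeredModel_isEven (U : ℝ) (u : ι → Site d) (θ : ι → ℝ) (w : κ → Site (d + 1)) (tz : κ → ℝ) :
    (layeredModel U u θ w tz).IsEven :=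
  vectorHoppingModel_isEven U _ _

/-- The layered model with non-zero in-plane jump vectors and interlayer vectors with `(w_b)₀ ≠ 0` is translation covariant on `ℤ^{d+1}`.
[cite: ArakiMoriya2003, §1 assumption (IV)] -/
theorem layeredModel_isTranslationInvariant (U : ℝ) {u : ι → Site d} (hu : ∀ a, u a ≠ 0) (θ : ι → ℝ) {w : κ → Site (d + 1)}
    (hw : ∀ b, w b 0 ≠ 0) (tz : κ → ℝ) : (layeredModel U u θ w tz).IsTranslationInvariant := by
  refine vectorHoppingModel_isTranslationInvariant U (fun c => ?_) _
  rcases c with a | b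
  · exact layerHom_ne_zero (hu a)
  · intro h
    exact hw b (by rw [show w b = Sum.elim (fun a => layerHom d (u a)) w (Sum.inr b) from rfl, h]; rfl)

/-- The layered model has range `R'` when `1 ≤ R ≤ R'`, the in-plane vectors lie in `thicken {0} R` and the interlayer ones in `thicken {0} R'`.
[cite: ArakiMoriya2003, §5.4 (finite range potentials)] -/
theorem layeredModel_hasFiniteRange (U : ℝ) {u : ι → Site d} (θ : ι → ℝ) {w : κ → Site (d + 1)} (tz : κ → ℝ) {R R' : ℝ} (hR : 1 ≤ R)
    (hRR' : R ≤ R') (huR : ∀ a, u a ∈ thicken ({0} : Finset (Site d)) R) (hwR' : ∀ b, w b ∈ thicken ({0} : Finset (Site (d + 1))) R') :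
    (layeredModel U u θ w tz).HasFiniteRange R' := by
  refine vectorHoppingModel_hasFiniteRange U _ _ (hR.trans hRR') fun c => ?_
  rcases c with a | b
  · exact thicken_mono _ hRR' (layerHom_mem_thicken (huR a))
  · exact hwR' b

/-- The layered `t–t'` crystal is Hermitian, even, translation covariant and of range `R' ≥ 1` (interlayer vectors in `thicken {0} R'`, `(w_b)₀ ≠ 0`).
[cite: PavariniEtAl2001, eq. (1)] [cite: ArakiMoriya2003, §1 assumptions (II), (IV)] -/
theorem layeredHubbardTTPrime_structure (t t' U : ℝ) {w : κ → Site 3} (hw : ∀ b, w b 0 ≠ 0) (tz : κ → ℝ) {R' : ℝ} (hR' : 1 ≤ R')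
    (hwR' : ∀ b, w b ∈ thicken ({0} : Finset (Site 3)) R') :
    (layeredHubbardTTPrime t t' U w tz).IsHermitian ∧ (layeredHubbardTTPrime t t' U w tz).IsEven ∧
      (layeredHubbardTTPrime t t' U w tz).IsTranslationInvariant ∧ (layeredHubbardTTPrime t t' U w tz).HasFiniteRange R' :=
  ⟨layeredModel_isHermitian U _ _ w tz, layeredModel_isEven U _ _ w tz,
    layeredModel_isTranslationInvariant U ttPrimeVec_ne_zero _ hw tz,
    layeredModel_hasFiniteRange U _ tz le_rfl hR' ttPrimeVec_mem_thicken_one hwR'⟩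

/-- The grand-canonical layered `t–t'` crystal `Φ_layered − μn − hm` is Hermitian, even, translation covariant and of range `R' ≥ 1`.
[cite: ArakiMoriya2003, §1 assumptions (II), (IV)] -/
theorem gcLayeredHubbardTTPrime_structure (t t' U μ hz : ℝ) {w : κ → Site 3} (hw : ∀ b, w b 0 ≠ 0) (tz : κ → ℝ) {R' : ℝ} (hR' : 1 ≤ R')
    (hwR' : ∀ b, w b ∈ thicken ({0} : Finset (Site 3)) R') :
    (gcLayeredHubbardTTPrime t t' U μ hz w tz).IsHermitian ∧ (gcLayeredHubbardTTPrime t t' U μ hz w tz).IsEven ∧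
      (gcLayeredHubbardTTPrime t t' U μ hz w tz).IsTranslationInvariant ∧ (gcLayeredHubbardTTPrime t t' U μ hz w tz).HasFiniteRange R' := by
  obtain ⟨hH, hE, hT, hR⟩ := layeredHubbardTTPrime_structure t t' U hw tz hR' hwR'
  refine ⟨FermionInteraction.isHermitian_linearFamily hH (fun a => ?_) _, FermionInteraction.isEven_linearFamily hE (fun a => ?_) _,
    FermionInteraction.isTranslationInvariant_linearFamily hT (fun a => ?_) _,
    FermionInteraction.hasFiniteRange_linearFamily hR (fun a => ?_) _⟩
  · fin_cases a <;> [exact numberInteraction_isHermitian; exact spinImbalanceInteraction_isHermitian]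
  · fin_cases a <;> [exact numberInteraction_isEven; exact spinImbalanceInteraction_isEven]
  · fin_cases a <;> [exact numberInteraction_isTranslationInvariant; exact spinImbalanceInteraction_isTranslationInvariant]
  · fin_cases a <;> [exact numberInteraction_hasFiniteRange R' (zero_le_one.trans hR');
      exact spinImbalanceInteraction_hasFiniteRange R' (zero_le_one.trans hR')]

end Structure

/-! ### §2. Free-boundary pressures of layered crystals -/

section FreePressure

variable {ι : Type*} [Fintype ι] {κ : Type*} [Fintype κ]

/-- **DIMENSION RAISING FOR THE PHYSICAL PRESSURE**: for `β ≥ 0`, `d ≥ 1`, the free-boundary pressure of the layered crystal on `ℤ^{d+1}` lies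
within `β(4/π)Σ_b|tz_b|` above the free-boundary pressure of the one-band model on `ℤ^d`:
`P_free,d+1(β, layered) ∈ [P_free,d(β, one band), P_free,d + β(4/π)Σ|tz|]`. [cite: BratteliRobinsonII1997, Thm. 6.2.40] [cite: Israel1979, Thm. I.2.4] -/
theorem freePressure_layeredModel_mem_Icc (hd : 0 < d) {β : ℝ} (hβ : 0 ≤ β) (U : ℝ) {u : ι → Site d} (hu : ∀ a, u a ≠ 0) (θ : ι → ℝ)
    {w : κ → Site (d + 1)} (hw : ∀ b, w b 0 ≠ 0) (tz : κ → ℝ) {R R' : ℝ} (hR : 1 ≤ R) (hRR' : R ≤ R')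
    (huR : ∀ a, u a ∈ thicken ({0} : Finset (Site d)) R) (hwR' : ∀ b, w b ∈ thicken ({0} : Finset (Site (d + 1))) R') :
    (layeredModel U u θ w tz).freePressure β ∈
      Set.Icc ((vectorHoppingModel U u θ).freePressure β) ((vectorHoppingModel U u θ).freePressure β + β * (4 / Real.pi * ∑ b, |tz b|)) := by
  have h := varPressure_layeredModel_mem_Icc hd β U hu θ hw tz hR hRR' huR hwR'
  rw [(layeredModel U u θ w tz).varPressure_eq_freePressure (Nat.succ_pos d) (layeredModel_isHermitian U u θ w tz)
      (layeredModel_isEven U u θ w tz) (layeredModel_isTranslationInvariant U hu θ hw tz)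
      (layeredModel_hasFiniteRange U θ tz hR hRR' huR hwR') hβ,
    (vectorHoppingModel U u θ).varPressure_eq_freePressure hd (vectorHoppingModel_isHermitian U u θ) (vectorHoppingModel_isEven U u θ)
      (vectorHoppingModel_isTranslationInvariant U hu θ) (vectorHoppingModel_hasFiniteRange U u θ hR huR) hβ, abs_of_nonneg hβ] at h
  exact h

/-- **The 3D free-boundary box pressures of the layered `t–t'` crystal converge** (`β ≥ 0`):
`n^{-3} log Re Tr e^{−βH_{[0,n)³}} → P_free,3`. [cite: BratteliRobinsonII1997, §6.2.4 (Prop. 6.2.39 ff.)] -/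
theorem tendsto_boxLogPartitionFn_layeredHubbardTTPrime {β : ℝ} (hβ : 0 ≤ β) (t t' U : ℝ) {w : κ → Site 3} (hw : ∀ b, w b 0 ≠ 0)
    (tz : κ → ℝ) {R' : ℝ} (hR' : 1 ≤ R') (hwR' : ∀ b, w b ∈ thicken ({0} : Finset (Site 3)) R') :
    Tendsto (fun n : ℕ => Real.log (Matrix.partitionFn β ((layeredHubbardTTPrime t t' U w tz).localHamiltonian (halfOpenBox 3 n))).re /
      ((n : ℝ) ^ 3)) atTop (𝓝 ((layeredHubbardTTPrime t t' U w tz).freePressure β)) := by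
  obtain ⟨hH, hE, hT, hR⟩ := layeredHubbardTTPrime_structure t t' U hw tz hR' hwR'
  exact (layeredHubbardTTPrime t t' U w tz).tendsto_freePressure (by norm_num) hH hE hT hR hβ

/-- **`t–t'` instance**: `P_free,3(β, layered t–t') ∈ [P_free,2(β, t–t'), + β(4/π)Σ|tz|]`. [cite: PavariniEtAl2001, eq. (1)] [cite: Israel1979, Thm. I.2.4] -/
theorem freePressure_layeredHubbardTTPrime_mem_Icc {β : ℝ} (hβ : 0 ≤ β) (t t' U : ℝ) {w : κ → Site 3} (hw : ∀ b, w b 0 ≠ 0) (tz : κ → ℝ)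
    {R' : ℝ} (hR' : 1 ≤ R') (hwR' : ∀ b, w b ∈ thicken ({0} : Finset (Site 3)) R') :
    (layeredHubbardTTPrime t t' U w tz).freePressure β ∈
      Set.Icc ((hubbardTTPrimeFermionInteraction t t' U).freePressure β)
        ((hubbardTTPrimeFermionInteraction t t' U).freePressure β + β * (4 / Real.pi * ∑ b, |tz b|)) := by
  rw [hubbardTTPrimeFermionInteraction_eq_vectorHoppingModel]
  exact freePressure_layeredModel_mem_Icc two_pos hβ U ttPrimeVec_ne_zero (ttPrimeAmp t t') hw tz le_rfl hR' ttPrimeVec_mem_thicken_one hwR'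

/-- **Grand-canonical `t–t'` instance, keyed to the 2D pressure of record**: for `β ≥ 0`, `U ≥ 0`:
`P_free,3(β; layered t–t'; μ, h; tz) ∈ [gcPressureTT'Zeeman β t t' U μ h, gcPressureTT'Zeeman β t t' U μ h + β(4/π)Σ_b|tz_b|]`, and the 3D
free-boundary box pressures converge to it. [cite: BratteliRobinsonII1997, Thm. 6.2.40] [cite: Israel1979, Thm. I.2.4] -/
theorem freePressure_gcLayeredHubbardTTPrime_mem_Icc {β : ℝ} (hβ : 0 ≤ β) (t t' : ℝ) {U : ℝ} (hU : 0 ≤ U) (μ hz : ℝ) {w : κ → Site 3}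
    (hw : ∀ b, w b 0 ≠ 0) (tz : κ → ℝ) {R' : ℝ} (hR' : 1 ≤ R') (hwR' : ∀ b, w b ∈ thicken ({0} : Finset (Site 3)) R') :
    (gcLayeredHubbardTTPrime t t' U μ hz w tz).freePressure β ∈
      Set.Icc (gcPressureTT'Zeeman β t t' U μ hz) (gcPressureTT'Zeeman β t t' U μ hz + β * (4 / Real.pi * ∑ b, |tz b|)) := by
  obtain ⟨hH, hE, hT, hR⟩ := gcLayeredHubbardTTPrime_structure t t' U μ hz hw tz hR' hwR'
  rw [← (gcLayeredHubbardTTPrime t t' U μ hz w tz).varPressure_eq_freePressure (by norm_num) hH hE hT hR hβ]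
  exact varPressure_gcLayeredHubbardTTPrime_mem_Icc_gcPressureTT'Zeeman hβ t t' hU μ hz hw tz hR' hwR'

/-- … with the convergence of the 3D box pressures made explicit. [cite: BratteliRobinsonII1997, §6.2.4 (Prop. 6.2.39 ff.)] -/
theorem tendsto_boxLogPartitionFn_gcLayeredHubbardTTPrime {β : ℝ} (hβ : 0 ≤ β) (t t' U μ hz : ℝ) {w : κ → Site 3} (hw : ∀ b, w b 0 ≠ 0)
    (tz : κ → ℝ) {R' : ℝ} (hR' : 1 ≤ R') (hwR' : ∀ b, w b ∈ thicken ({0} : Finset (Site 3)) R') :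
    Tendsto (fun n : ℕ => Real.log (Matrix.partitionFn β ((gcLayeredHubbardTTPrime t t' U μ hz w tz).localHamiltonian (halfOpenBox 3 n))).re /
      ((n : ℝ) ^ 3)) atTop (𝓝 ((gcLayeredHubbardTTPrime t t' U μ hz w tz).freePressure β)) := by
  obtain ⟨hH, hE, hT, hR⟩ := gcLayeredHubbardTTPrime_structure t t' U μ hz hw tz hR' hwR'
  exact (gcLayeredHubbardTTPrime t t' U μ hz w tz).tendsto_freePressure (by norm_num) hH hE hT hR hβ

end FreePressure

/-! ### §3. Thermodynamic-limit equilibrium states of the layered GC crystal exist and are read by 2D pressures -/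

section Equilibria

variable {κ : Type*} [Fintype κ]

/-- **EQUILIBRIUM STATES OF THE 3D LAYERED GC `t–t'` CRYSTAL EXIST, AND EVERY ONE HAS ITS DENSITY IN THE 2D WINDOW**: for `β > 0`, `U ≥ 0`,
`δ > 0`, there is a translation-invariant variational equilibrium state at `(β; t,t',U; μ,h; tz)`, and for EVERY such state
`ρ(ω) ∈ [(P₂(μ) − P₂(μ−δ) − β(4/π)Σ|tz|)/(βδ), (P₂(μ+δ) − P₂(μ) + β(4/π)Σ|tz|)/(βδ)]`, `P₂ = gcPressureTT'Zeeman β t t' U · h`.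
[cite: Griffiths1964, Eq. (39) and Fig. 3] [cite: Israel1979, Thm. I.2.4] -/
theorem exists_isVarEquilibrium_gcLayered_density_mem_Icc {β : ℝ} (hβ : 0 < β) (t t' : ℝ) {U : ℝ} (hU : 0 ≤ U) (μ hz : ℝ)
    {w : κ → Site 3} (hw : ∀ b, w b 0 ≠ 0) (tz : κ → ℝ) {R' : ℝ} (hR' : 1 ≤ R') (hwR' : ∀ b, w b ∈ thicken ({0} : Finset (Site 3)) R')
    {δ : ℝ} (hδ : 0 < δ) :
    (∃ ω : InfVolFermionState 3, ω.IsVarEquilibrium β (gcLayeredHubbardTTPrime t t' U μ hz w tz) R') ∧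
      ∀ ω : InfVolFermionState 3, ω.IsVarEquilibrium β (gcLayeredHubbardTTPrime t t' U μ hz w tz) R' →
        ω.density ∈ Set.Icc
          ((gcPressureTT'Zeeman β t t' U μ hz - gcPressureTT'Zeeman β t t' U (μ - δ) hz - β * (4 / Real.pi * ∑ b, |tz b|)) / (β * δ))
          ((gcPressureTT'Zeeman β t t' U (μ + δ) hz - gcPressureTT'Zeeman β t t' U μ hz + β * (4 / Real.pi * ∑ b, |tz b|)) / (β * δ)) :=
  ⟨(gcLayeredHubbardTTPrime t t' U μ hz w tz).exists_isVarEquilibrium (by norm_num) β R',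
    fun _ hω => hω.density_mem_Icc_of_gcLayered hβ t t' hU μ hz hw tz hR' hwR' hδ⟩

/-- The same equilibrium states realise the 3D free-boundary pressure: `s̄(ω) − β u(ω) = P_free,3` (`β ≥ 0`).
[cite: BratteliRobinsonII1997, Thm. 6.2.40] -/
theorem IsVarEquilibrium.entropyDensitySup_sub_mul_eq_freePressure_gcLayered {β : ℝ} (hβ : 0 ≤ β) (t t' U μ hz : ℝ) {w : κ → Site 3}
    (hw : ∀ b, w b 0 ≠ 0) (tz : κ → ℝ) {R' : ℝ} (hR' : 1 ≤ R') (hwR' : ∀ b, w b ∈ thicken ({0} : Finset (Site 3)) R')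
    {ω : InfVolFermionState 3} (hω : ω.IsVarEquilibrium β (gcLayeredHubbardTTPrime t t' U μ hz w tz) R') :
    ω.entropyDensitySup - β * ω.meanEnergy (gcLayeredHubbardTTPrime t t' U μ hz w tz) R' = (gcLayeredHubbardTTPrime t t' U μ hz w tz).freePressure β := by
  obtain ⟨hH, hE, hT, hR⟩ := gcLayeredHubbardTTPrime_structure t t' U μ hz hw tz hR' hwR'
  rw [hω.2, (gcLayeredHubbardTTPrime t t' U μ hz w tz).varPressure_eq_freePressure (by norm_num) hH hE hT hR hβ]

end Equilibria

end Literature.MathematicalPhysics.QuantumLattice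

end
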